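import Mathlib
import HarnessLib

/-!
# QUANT lane R8 tool: the dual certificate for RATIO-REGULAR laws —
# a linear functional is bounded below on every law `p` with `μ·p(b−1) ≤ b·p(b)` (`b ≤ μ`) as soon as one
# multiplier `ν` separates the Poisson-weighted tails from the top atoms

builds on p205010 (kernel theorem, internal audit signed; external expert review pending)

Support file (`--supports stmt-CriticalPhenomena-4575`), QUANT lane typer seat prim-quant-stmt (gen 12); memo
`run/shared/lean/prim/quant/prim-quant-stmt-g12/MTL-PROFILE-LP.md` §4 (the LP/vertex reduction of FAR for 'hub + any root blocks').
Pure real algebra on finite sums; theorems only; no definitions, no sorries, standard axioms.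

**Setting.**  A law `p` on `{0,…,m}` (`p b ≥ 0`, `Σ p = 1`) with mean `μ = Σ b·p b`, `0 < μ`, and an integer `n ≤ μ` (the natural choice is `n = ⌊μ⌋`; `μ < n+1` is NOT needed), which is
RATIO-REGULAR below the mean: `μ·p(b−1) ≤ b·p(b)` for `1 ≤ b ≤ n` (every Poisson-binomial law is, `Quant.pb_ratio`).  A test function
`ℓ : ℕ → ℝ` and a level `τ`.  Write `w i = μ^i/i!` (Poisson weights) and `s b = ℓ b − τ − ν·(b − μ)`.

* `Quant.ratioRegular_expectation_ge` — if a real `ν` satisfies (top atoms) `ν·(b − μ) ≤ ℓ b − τ` for `n < b ≤ m` and (Poisson tails)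
  `0 ≤ Σ_{i=t}^{n} s i · w i` for every `t ≤ n`, then `τ ≤ Σ_{b ≤ m} p b · ℓ b`.
  Proof: `Σ p·ℓ − τ = Σ_b p b · s b` (the `ν`-term integrates to `0` by the mean identity); the atoms `b > n` contribute `≥ 0`; on `b ≤ n`,
  Abel summation against the Poisson weights: with `q b = p b / w b` (nondecreasing by ratio-regularity) and `T b = Σ_{i=b}^{n} s i w i ≥ 0`,
  `Σ_{b≤n} p b s b = q 0 · T 0 + Σ_{b=1}^{n} (q b − q (b−1))·T b ≥ 0`.
  This is the explicit LP-duality step of the memo: the two families of hypotheses are the vertex inequalities `(V_{t,b₁})` of the polytope of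
  ratio-regular laws (vertices = Poisson(μ)-shape on `[t,n]` ⊕ an atom at `b₁`), separated by `ν`; so a proof of the `(V_{t,b₁})` for the test
  function `ℓ b = P(W ≥ j+1−c−b) + ρ·P(W ≥ j+1)` of a root block-sum `W` closes FAR for 'hub + any root blocks' through `Quant.pb_ratio`.
[this work]
-/

noncomputable section

namespace Summit.CriticalPhenomena.PercolationContinuityZ3.Theorems

namespace Quant

open Finset

/-- Tail sums of a sequence over `[b, n]`: `Σ_{i ∈ Ico b (n+1)} f i` splits off its bottom term. [folklore] -/
theorem sum_Ico_succ_bot {f : ℕ → ℝ} {b n : ℕ} (hb : b ≤ n) :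
    ∑ i ∈ Finset.Ico b (n + 1), f i = f b + ∑ i ∈ Finset.Ico (b + 1) (n + 1), f i := by
  rw [Finset.sum_eq_sum_Ico_succ_bot (by omega)]

/-- **Abel summation against nonnegative tails.**  If `q 0, …, q n` is nondecreasing with `q 0 ≥ 0` and the tails
`T b = Σ_{i=b}^{n} g i` are all `≥ 0`, then `Σ_{b ≤ n} q b · g b ≥ 0`. [folklore] -/
theorem sum_mul_nonneg_of_monotone_of_tails_nonneg (q g : ℕ → ℝ) (n : ℕ) (hq0 : 0 ≤ q 0)
    (hmono : ∀ b, 1 ≤ b → b ≤ n → q (b - 1) ≤ q b)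
    (htail : ∀ b, b ≤ n → 0 ≤ ∑ i ∈ Finset.Ico b (n + 1), g i) :
    0 ≤ ∑ b ∈ Finset.range (n + 1), q b * g b := by
  -- induction on `n` with the statement generalized over `q`, `g` is awkward; instead prove the stronger claim
  -- `Σ_{b ∈ Ico t (n+1)} q b g b ≥ q t · T t ≥ 0` by downward induction on `t`.
  have key : ∀ d t : ℕ, t + d = n → q t * (∑ i ∈ Finset.Ico t (n + 1), g i) ≤ ∑ b ∈ Finset.Ico t (n + 1), q b * g b := by
    intro d
    induction d with
    | zero =>
      intro t ht
      have htn : t = n := by omega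
      subst htn
      simp [Nat.Ico_succ_singleton]
    | succ d ih =>
      intro t ht
      have htn : t ≤ n := by omega
      have ht1 : t + 1 + d = n := by omega
      have ih' := ih (t + 1) ht1
      rw [sum_Ico_succ_bot htn, sum_Ico_succ_bot (f := fun b => q b * g b) htn, mul_add]
      -- `q t · T (t+1) ≤ q (t+1) · T (t+1) ≤ Σ_{b ≥ t+1} q b g b`
      have hT1 : 0 ≤ ∑ i ∈ Finset.Ico (t + 1) (n + 1), g i := by
        rcases Nat.lt_or_ge n (t + 1) with h | h
        · rw [Finset.Ico_eq_empty (by omega)]; simp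
        · exact htail (t + 1) h
      have hqq : q t ≤ q (t + 1) := by
        have := hmono (t + 1) (by omega) (by omega)
        simpa using this
      have : q t * ∑ i ∈ Finset.Ico (t + 1) (n + 1), g i ≤ q (t + 1) * ∑ i ∈ Finset.Ico (t + 1) (n + 1), g i :=
        mul_le_mul_of_nonneg_right hqq hT1
      linarith
  have h0 := key n 0 (by omega)
  have hT0 : 0 ≤ ∑ i ∈ Finset.Ico 0 (n + 1), g i := htail 0 (Nat.zero_le n)
  have : 0 ≤ q 0 * ∑ i ∈ Finset.Ico 0 (n + 1), g i := mul_nonneg hq0 hT0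
  rw [Finset.range_eq_Ico]
  linarith

/-- **The certificate for ratio-regular laws.**  Let `p` be a law on `{0,…,m}` with mean `μ > 0` and let `n ≤ μ` (e.g. `n = ⌊μ⌋`), `p` ratio-regular below
the mean (`μ·p(b−1) ≤ b·p(b)` for `1 ≤ b ≤ n`).  If some real `ν` satisfies `ν·(b − μ) ≤ ℓ b − τ` for all `n < b ≤ m` and
`0 ≤ Σ_{i=t}^{n} (ℓ i − τ − ν·(i − μ))·μ^i/i!` for all `t ≤ n`, then `τ ≤ Σ_{b ≤ m} p b · ℓ b`. [this work] -/
theorem ratioRegular_expectation_ge (m n : ℕ) (μ τ ν : ℝ) (p ℓ : ℕ → ℝ) (hμ0 : 0 < μ) (hnμ : (n : ℝ) ≤ μ)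
    (hp0 : ∀ b, 0 ≤ p b)
    (hsum : ∑ b ∈ Finset.range (m + 1), p b = 1) (hmean : ∑ b ∈ Finset.range (m + 1), (b : ℝ) * p b = μ)
    (hratio : ∀ b, 1 ≤ b → b ≤ n → μ * p (b - 1) ≤ (b : ℝ) * p b)
    (htop : ∀ b, n < b → b ≤ m → ν * ((b : ℝ) - μ) ≤ ℓ b - τ)
    (htail : ∀ t, t ≤ n → 0 ≤ ∑ i ∈ Finset.Ico t (n + 1), (ℓ i - τ - ν * ((i : ℝ) - μ)) * (μ ^ i / (Nat.factorial i : ℝ))) :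
    τ ≤ ∑ b ∈ Finset.range (m + 1), p b * ℓ b := by
  -- `n ≤ m` (the mean is at most the top of the support)
  have hnm : n ≤ m := by
    by_contra h
    push Not at h
    -- all mass sits on `b ≤ m < n ≤ μ`, contradicting `mean = μ`
    have : ∑ b ∈ Finset.range (m + 1), (b : ℝ) * p b ≤ ∑ b ∈ Finset.range (m + 1), (m : ℝ) * p b := by
      refine Finset.sum_le_sum fun b hb => ?_
      have : (b : ℝ) ≤ m := by have := Finset.mem_range.1 hb; exact_mod_cast (by omega)
      exact mul_le_mul_of_nonneg_right this (hp0 b)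
    rw [hmean, ← Finset.mul_sum, hsum, mul_one] at this
    have : (m : ℝ) < n := by exact_mod_cast h
    linarith
  set s : ℕ → ℝ := fun b => ℓ b - τ - ν * ((b : ℝ) - μ) with hs
  set w : ℕ → ℝ := fun i => μ ^ i / (Nat.factorial i : ℝ) with hw
  have hw0 : ∀ i, 0 < w i := fun i => by rw [hw]; positivity
  -- (1) `Σ p ℓ − τ = Σ p s`
  have hS : ∑ b ∈ Finset.range (m + 1), p b * ℓ b - τ = ∑ b ∈ Finset.range (m + 1), p b * s b := by
    have e : ∀ b : ℕ, p b * s b = p b * ℓ b - τ * p b - ν * ((b : ℝ) * p b) + ν * μ * p b := fun b => by rw [hs]; ring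
    rw [Finset.sum_congr rfl fun b _ => e b, Finset.sum_add_distrib, Finset.sum_sub_distrib, Finset.sum_sub_distrib,
      ← Finset.mul_sum, ← Finset.mul_sum, ← Finset.mul_sum, hsum, hmean]
    ring
  -- (2) split at `n`: atoms above `n` are nonnegative termwise
  have hsplit : ∑ b ∈ Finset.range (m + 1), p b * s b =
      ∑ b ∈ Finset.range (n + 1), p b * s b + ∑ b ∈ Finset.Ico (n + 1) (m + 1), p b * s b := by
    rw [Finset.range_eq_Ico, Finset.range_eq_Ico]
    exact (Finset.sum_Ico_consecutive (fun b => p b * s b) (by omega) (by omega)).symm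
  have htopsum : 0 ≤ ∑ b ∈ Finset.Ico (n + 1) (m + 1), p b * s b := by
    refine Finset.sum_nonneg fun b hb => ?_
    rw [Finset.mem_Ico] at hb
    have h1 := htop b (by omega) (by omega)
    have : 0 ≤ s b := by rw [hs]; linarith
    exact mul_nonneg (hp0 b) this
  -- (3) the low part by Abel summation: `p b s b = q b · (s b w b)` with `q = p/w` nondecreasing and the tails of `s·w` nonnegative
  have hlow : 0 ≤ ∑ b ∈ Finset.range (n + 1), p b * s b := by
    have e : ∀ b : ℕ, p b * s b = (p b / w b) * (s b * w b) := by
      intro b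
      have := (hw0 b).ne'
      field_simp
    rw [Finset.sum_congr rfl fun b _ => e b]
    refine sum_mul_nonneg_of_monotone_of_tails_nonneg (fun b => p b / w b) (fun b => s b * w b) n
      (div_nonneg (hp0 0) (hw0 0).le) ?_ ?_
    · -- monotonicity of `p/w` from ratio-regularity: `p(b−1)/w(b−1) ≤ p b / w b ⟺ μ p(b−1) ≤ b p b`
      intro b hb1 hbn
      have hr := hratio b hb1 hbn
      have hwb : w b * (b : ℝ) = w (b - 1) * μ := by
        rw [hw]
        simp only
        obtain ⟨b', rfl⟩ : ∃ b', b = b' + 1 := ⟨b - 1, by omega⟩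
        simp only [Nat.add_sub_cancel, Nat.factorial_succ, pow_succ]
        push_cast
        have hf : (Nat.factorial b' : ℝ) ≠ 0 := by positivity
        field_simp
      rw [div_le_div_iff₀ (hw0 (b - 1)) (hw0 b)]
      -- `p(b−1) · w b ≤ p b · w(b−1)`; multiply `hr` by `w(b−1)/μ`-type identity
      have hb0 : (0 : ℝ) < b := by exact_mod_cast hb1
      have key : p (b - 1) * w b * (b : ℝ) ≤ p b * w (b - 1) * (b : ℝ) := by
        calc p (b - 1) * w b * (b : ℝ) = p (b - 1) * (w b * (b : ℝ)) := by ring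
          _ = p (b - 1) * (w (b - 1) * μ) := by rw [hwb]
          _ = (μ * p (b - 1)) * w (b - 1) := by ring
          _ ≤ ((b : ℝ) * p b) * w (b - 1) := mul_le_mul_of_nonneg_right hr (hw0 _).le
          _ = p b * w (b - 1) * (b : ℝ) := by ring
      exact le_of_mul_le_mul_right key hb0
    · intro t ht
      have := htail t ht
      refine le_of_le_of_eq this (Finset.sum_congr rfl fun i _ => ?_)
      rw [hs, hw]
  -- assemble
  have : 0 ≤ ∑ b ∈ Finset.range (m + 1), p b * ℓ b - τ := by
    rw [hS, hsplit]; exact add_nonneg hlow htopsum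
  linarith

end Quant

end Summit.CriticalPhenomena.PercolationContinuityZ3.Theorems
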